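import Literature.LinearAlgebra.BandMatrix.LocalizingLargeMatrices
import Mathlib.Algebra.Order.Chebyshev
import HarnessLib

/-!
# Localizing large matrices — proof of [LSSY2005, Thm. 10.6] (discharge of `LSSY2005_thm10_6`)

This file proves `theorem LSSY2005_thm10_6_holds : LSSY2005_thm10_6`, discharging the named fact
vendored in `Literature.LinearAlgebra.BandMatrix.LocalizingLargeMatrices` (statement, the vocabulary
`bandPart`, `quadForm`, and the references are there). Nothing else is added — no definitions, no
named facts, no syntax; the auxiliary objects of the proof (the window `f`, the translates `v m`,
the band sums `γ k`, the normalisation `F₂`) are introduced inside the main proof by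
`obtain ⟨f, hf⟩ : ∃ f, ∀ s, f s = …`, and the helper lemmas take the defining equation `hf` as a
hypothesis.

We follow the published proof, E. H. Lieb and J. P. Solovej [LiebSolovej2001, Appendix,
Thm. 10.1 (arXiv:cond-mat/0007425 §10)], to which [LSSY2005, Thm. 10.6] refers for the proof:

* a window `f : ℤ → ℝ` supported on `M` consecutive integers (Lieb–Solovej
  take the normalised tent `A_M [M+1-2|s|]` for `M` odd — we take the un-normalised tent
  `f(s) = max(0, min(s+1, M-s))` on `[0, M-1]`, which avoids the parity split, and divide by
  `F₂ = ∑_s f(s)²` instead of normalising);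
* the translates `φ^{(m)}_j = f(j-m) ψ_j` (`v m` below) and the two bookkeeping identities
  `∑_m (φ^{(m)}, 𝒜 φ^{(m)}) = F₂ λ - ½ ∑_k γ_k d_k`, `∑_m ‖φ^{(m)}‖² = F₂` with
  `γ_k = ∑_s (f(s+k) - f(s))²` (the paper's `γ_k` is `½ γ_k / F₂` here);
* the choice `σ = (2F₂)⁻¹ ∑_k γ_k |d_k|`, which makes `∑_m K^{(m)} ≤ 0`, so some `φ^{(m)} ≠ 0` has
  Rayleigh quotient `≤ λ + σ`;
* the estimate `γ_k ≤ 2 M k²` for `k < M` (`f` is 1-Lipschitz), `γ_k = 2F₂` for `k ≥ M` (disjoint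
  supports) and `F₂ ≥ M³/36` (Cauchy–Schwarz with `∑_{s<M} (s+1)(M-s) = M(M+1)(M+2)/6`), giving
  (10.8) with the explicit universal constant `C = 36`.

Hermiticity of `𝒜` is not used (the vendored statement compares real parts and uses `‖d_k‖`,
and `Re d_k ≥ -‖d_k‖`). -/

namespace Literature.LinearAlgebra.BandMatrix

open scoped Matrix

section LiebSolovejProof

open Finset

/-- Reindexing a finite sum along an injection that hits every non-vanishing term
(bookkeeping for the "sums over `ℤ`" of the Lieb–Solovej proof). [folklore] -/
private theorem sum_reindex_of_ne_zero {ι κ : Type*} (X : Finset ι) (Y : Finset κ) (g : κ → ℝ)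
    (e : ι → κ) (he : Function.Injective e)
    (hX : ∀ y ∈ Y, g y ≠ 0 → ∃ x ∈ X, e x = y)
    (hY : ∀ x ∈ X, g (e x) ≠ 0 → e x ∈ Y) :
    ∑ x ∈ X, g (e x) = ∑ y ∈ Y, g y := by
  refine Finset.sum_bij_ne_zero (fun x _ _ => e x) (fun x hx hne => hY x hx hne)
    (fun x₁ _ _ x₂ _ _ h => he h) (fun y hy hne => ?_) (fun _ _ _ => rfl)
  obtain ⟨x, hx, rfl⟩ := hX y hy hne
  exact ⟨x, hx, hne, rfl⟩

/-- Triple sum commutation `∑_m ∑_i ∑_j = ∑_i ∑_j ∑_m`. [folklore] -/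
private theorem sum_sum_sum_comm {N : ℕ} {α : Type*} (s : Finset α) (F : α → Fin N → Fin N → ℂ) :
    ∑ m ∈ s, ∑ i : Fin N, ∑ j : Fin N, F m i j = ∑ i : Fin N, ∑ j : Fin N, ∑ m ∈ s, F m i j := by
  rw [Finset.sum_comm]
  exact Finset.sum_congr rfl fun i _ => Finset.sum_comm

/-! ### The window function -/

/-! Throughout, the window is a function `f : ℤ → ℝ` together with its defining equation
`hf : ∀ s, f s = max 0 (min ((s : ℝ) + 1) ((M : ℝ) - s))` — the (un-normalised) tent
`f(s) = max(0, min(s+1, M-s))`, supported on `0 ≤ s ≤ M-1` (Lieb–Solovej's `A_M[M+1-2|s|]`,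
shifted and un-normalised). -/

/-- `f(s) = 0` outside `[0, M-1]`. [cite: LiebSolovej2001, App. Thm. 10.1 proof] -/
private theorem lsWindow_eq_zero {M : ℕ} {f : ℤ → ℝ}
    (hf : ∀ s : ℤ, f s = max 0 (min ((s : ℝ) + 1) ((M : ℝ) - s))) {s : ℤ}
    (h : s < 0 ∨ (M : ℤ) ≤ s) : f s = 0 := by
  rw [hf]
  apply max_eq_left
  rcases h with h | h
  · have h' : ((s + 1 : ℤ) : ℝ) ≤ 0 := by exact_mod_cast (show s + 1 ≤ 0 by omega)
    push_cast at h'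
    exact min_le_of_left_le h'
  · have h' : (M : ℝ) ≤ (s : ℝ) := by exact_mod_cast h
    exact min_le_of_right_le (by linarith)

/-- `f(s) ≠ 0` forces `0 ≤ s < M`. [cite: LiebSolovej2001, App. Thm. 10.1 proof] -/
private theorem lsWindow_ne_zero {M : ℕ} {f : ℤ → ℝ}
    (hf : ∀ s : ℤ, f s = max 0 (min ((s : ℝ) + 1) ((M : ℝ) - s))) {s : ℤ}
    (h : f s ≠ 0) : 0 ≤ s ∧ s < M := by
  by_contra h'
  exact h (lsWindow_eq_zero hf (by omega))

/-- Lower bound `(M+1) f(s) ≥ (s+1)(M-s)` on the support.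
[cite: LiebSolovej2001, App. Thm. 10.1 proof] -/
private theorem lsWindow_ge {M : ℕ} {f : ℤ → ℝ}
    (hf : ∀ s : ℤ, f s = max 0 (min ((s : ℝ) + 1) ((M : ℝ) - s))) {s : ℕ} (hM : s < M) :
    ((s : ℝ) + 1) * ((M : ℝ) - s) ≤ ((M : ℝ) + 1) * f s := by
  rw [hf, show (((s : ℤ) : ℝ)) = (s : ℝ) from Int.cast_natCast s]
  have hs0 : (0 : ℝ) ≤ s := Nat.cast_nonneg s
  have hsM : (s : ℝ) < M := by exact_mod_cast hM
  have ha : (0 : ℝ) < (s : ℝ) + 1 := by linarith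
  have hb : (0 : ℝ) < (M : ℝ) - s := by linarith
  have hmin : ((s : ℝ) + 1) * ((M : ℝ) - s) ≤ ((M : ℝ) + 1) * min ((s : ℝ) + 1) ((M : ℝ) - s) := by
    rcases min_choice ((s : ℝ) + 1) ((M : ℝ) - s) with h | h <;> rw [h] <;>
      nlinarith [min_le_left ((s : ℝ) + 1) ((M : ℝ) - s), min_le_right ((s : ℝ) + 1) ((M : ℝ) - s)]
  refine hmin.trans ?_
  gcongr
  exact le_max_right _ _

/-- `|max(0,min(a,b)) - max(0,min(c,d))| ≤ max(|a-c|,|b-d|)`. [folklore] -/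
private theorem abs_clamp_sub_clamp_le (a b c d : ℝ) :
    |max 0 (min a b) - max 0 (min c d)| ≤ max |a - c| |b - d| := by
  calc |max 0 (min a b) - max 0 (min c d)|
      ≤ max |(0 : ℝ) - 0| |min a b - min c d| := abs_max_sub_max_le_max _ _ _ _
    _ = |min a b - min c d| := by rw [sub_self, abs_zero, max_eq_right (abs_nonneg _)]
    _ ≤ max |a - c| |b - d| := abs_min_sub_min_le_max _ _ _ _

/-- `f` is 1-Lipschitz: `|f(s+1) - f(s)| ≤ 1`. [cite: LiebSolovej2001, App. Thm. 10.1 proof] -/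
private theorem abs_lsWindow_succ_sub_le {M : ℕ} {f : ℤ → ℝ}
    (hf : ∀ s : ℤ, f s = max 0 (min ((s : ℝ) + 1) ((M : ℝ) - s))) (s : ℤ) :
    |f (s + 1) - f s| ≤ 1 := by
  rw [hf, hf]
  push_cast
  refine (abs_clamp_sub_clamp_le _ _ _ _).trans (max_le ?_ ?_)
  · rw [show (s : ℝ) + 1 + 1 - ((s : ℝ) + 1) = 1 by ring]; simp
  · rw [show (M : ℝ) - ((s : ℝ) + 1) - ((M : ℝ) - s) = -1 by ring]; simp

/-- `|f(s+k) - f(s)| ≤ k`. [cite: LiebSolovej2001, App. Thm. 10.1 proof] -/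
private theorem abs_lsWindow_add_sub_le {M : ℕ} {f : ℤ → ℝ}
    (hf : ∀ s : ℤ, f s = max 0 (min ((s : ℝ) + 1) ((M : ℝ) - s))) (s : ℤ) (k : ℕ) :
    |f (s + k) - f s| ≤ k := by
  induction k with
  | zero => simp
  | succ k ih =>
    simp only [Nat.cast_succ]
    calc |f (s + (k + 1)) - f s|
        ≤ |f (s + (k + 1)) - f (s + k)| + |f (s + k) - f s| :=
          abs_sub_le _ _ _
      _ ≤ 1 + k := by
          refine add_le_add ?_ ih
          have := abs_lsWindow_succ_sub_le hf (s + k)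
          rwa [add_assoc] at this
      _ = k + 1 := add_comm _ _

/-- `(f(s+k) - f(s))² ≤ k²`. [cite: LiebSolovej2001, App. Thm. 10.1 proof] -/
private theorem lsWindow_add_sub_sq_le {M : ℕ} {f : ℤ → ℝ}
    (hf : ∀ s : ℤ, f s = max 0 (min ((s : ℝ) + 1) ((M : ℝ) - s))) (s : ℤ) (k : ℕ) :
    (f (s + k) - f s) ^ 2 ≤ (k : ℝ) ^ 2 := by
  rw [← sq_abs]
  exact pow_le_pow_left₀ (abs_nonneg _) (abs_lsWindow_add_sub_le hf s k) 2

/-- The power sum `∑_{s<M} (s+1)(x-s) = x M(M+1)/2 - (M-1)M(M+1)/3`. [folklore] -/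
private theorem sum_range_succ_mul_sub (M : ℕ) (x : ℝ) :
    ∑ s ∈ Finset.range M, ((s : ℝ) + 1) * (x - s)
      = x * M * (M + 1) / 2 - (M - 1) * M * (M + 1) / 3 := by
  induction M with
  | zero => simp
  | succ M ih => rw [Finset.sum_range_succ, ih]; push_cast; ring

/-- `F₂ ≥ M³/36` (Cauchy–Schwarz). [cite: LiebSolovej2001, App. Thm. 10.1 proof] -/
private theorem lsF2_ge {M : ℕ} {f : ℤ → ℝ}
    (hf : ∀ s : ℤ, f s = max 0 (min ((s : ℝ) + 1) ((M : ℝ) - s))) :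
    (M : ℝ) ^ 3 / 36 ≤ ∑ x ∈ Finset.range M, f x ^ 2 := by
  have hM0 : (0 : ℝ) ≤ M := Nat.cast_nonneg M
  have hsum' :
      (M : ℝ) * (M + 1) * (M + 2) / 6 ≤ ((M : ℝ) + 1) * ∑ s ∈ range M, f s := by
    calc (M : ℝ) * (M + 1) * (M + 2) / 6
        = ∑ s ∈ range M, ((s : ℝ) + 1) * ((M : ℝ) - s) := by
          rw [sum_range_succ_mul_sub]; ring
      _ ≤ ∑ s ∈ range M, ((M : ℝ) + 1) * f s :=
          Finset.sum_le_sum fun s hs => lsWindow_ge hf (Finset.mem_range.mp hs)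
      _ = ((M : ℝ) + 1) * ∑ s ∈ range M, f s := by rw [Finset.mul_sum]
  have hsum : (M : ℝ) * (M + 2) / 6 ≤ ∑ s ∈ range M, f s := by
    have hM1pos : (0 : ℝ) < (M : ℝ) + 1 := by positivity
    refine le_of_mul_le_mul_left ?_ hM1pos
    calc ((M : ℝ) + 1) * ((M : ℝ) * (M + 2) / 6) = (M : ℝ) * (M + 1) * (M + 2) / 6 := by ring
      _ ≤ ((M : ℝ) + 1) * ∑ s ∈ range M, f s := hsum'
  have hcs : (∑ s ∈ range M, f s) ^ 2
      ≤ #(range M) * ∑ s ∈ range M, f s ^ 2 :=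
    sq_sum_le_card_mul_sum_sq
  rw [Finset.card_range] at hcs
  have h1 : ((M : ℝ) * (M + 2) / 6) ^ 2 ≤ (∑ s ∈ range M, f s) ^ 2 :=
    pow_le_pow_left₀ (by positivity) hsum 2
  have h2 : (M : ℝ) * ((M : ℝ) ^ 3 / 36) ≤ M * ∑ x ∈ Finset.range M, f x ^ 2 := by
    refine le_trans ?_ (h1.trans hcs)
    nlinarith [mul_nonneg (mul_nonneg hM0 hM0) hM0, mul_nonneg hM0 hM0]
  rcases Nat.eq_zero_or_pos M with h | h
  · subst h; simp
  · exact le_of_mul_le_mul_left h2 (by exact_mod_cast h)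

/-- `F₂ > 0` for `M ≥ 1`. [cite: LiebSolovej2001, App. Thm. 10.1 proof] -/
private theorem lsF2_pos {M : ℕ} {f : ℤ → ℝ}
    (hf : ∀ s : ℤ, f s = max 0 (min ((s : ℝ) + 1) ((M : ℝ) - s))) (hM : 0 < M) :
    0 < ∑ x ∈ Finset.range M, f x ^ 2 :=
  lt_of_lt_of_le (by have : (0 : ℝ) < M := (by exact_mod_cast hM); positivity) (lsF2_ge hf)

/-! ### The translates and the two bookkeeping identities -/

/-! The translation parameters `m` that matter range over `Finset.Icc (-M) (N+M) ⊇` all `m` whose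
window meets `[0, N)`; `γ_k = ∑_s (f(s+k) - f(s))²` is summed over `Finset.Icc (-N-M) (N+M)`, a
range containing every non-zero term for `k < N`. -/

/-- `∑_{m} f(i-m)² = F₂` for every index `i`. [cite: LiebSolovej2001, App. Thm. 10.1 proof] -/
private theorem sum_lsT_window_sq {N M : ℕ} {f : ℤ → ℝ}
    (hf : ∀ s : ℤ, f s = max 0 (min ((s : ℝ) + 1) ((M : ℝ) - s))) (i : Fin N) :
    ∑ m ∈ Finset.Icc (-(M : ℤ)) (N + M), f (((i : ℕ) : ℤ) - m) ^ 2
      = ∑ x ∈ Finset.range M, f x ^ 2 := by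
  have hi := i.isLt
  have key := sum_reindex_of_ne_zero (Finset.range M) (Finset.Icc (-(M : ℤ)) (N + M))
    (fun m => f (((i : ℕ) : ℤ) - m) ^ 2) (fun t : ℕ => ((i : ℕ) : ℤ) - t)
    (by intro a b h; simp only at h; omega)
    (by
      intro m _ hne
      have h := lsWindow_ne_zero hf ((pow_ne_zero_iff two_ne_zero).mp hne)
      exact ⟨(((i : ℕ) : ℤ) - m).toNat, by simp only [Finset.mem_range]; omega, by omega⟩)
    (by
      intro t ht _
      simp only [Finset.mem_range] at ht
      simp only [Finset.mem_Icc]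
      omega)
  simp only [sub_sub_cancel] at key
  rw [← key]

/-- `∑_{m} (f(i-m) - f(j-m))² = γ_{|i-j|}`. [cite: LiebSolovej2001, App. Thm. 10.1 proof] -/
private theorem sum_lsT_window_sub_sq {N M : ℕ} {f : ℤ → ℝ}
    (hf : ∀ s : ℤ, f s = max 0 (min ((s : ℝ) + 1) ((M : ℝ) - s))) (i j : Fin N) :
    ∑ m ∈ Finset.Icc (-(M : ℤ)) (N + M), (f (((i : ℕ) : ℤ) - m) - f (((j : ℕ) : ℤ) - m)) ^ 2
      = ∑ s ∈ Finset.Icc (-(N : ℤ) - M) (N + M), (f (s + (i : ℕ).dist j) - f s) ^ 2 := by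
  wlog hji : (j : ℕ) ≤ i generalizing i j
  · have h := this j i (le_of_not_ge hji)
    rw [Nat.dist_comm] at h
    rw [← h]
    exact Finset.sum_congr rfl fun m _ => by ring
  have hi := i.isLt
  obtain ⟨k, hk⟩ : ∃ k : ℕ, (i : ℕ) = j + k := ⟨i - j, by omega⟩
  have hdist : (i : ℕ).dist j = k := by rw [Nat.dist_eq_sub_of_le_right hji]; omega
  have hik : (((i : ℕ) : ℤ)) = ((j : ℕ) : ℤ) + k := by exact_mod_cast hk
  rw [hdist, hik]
  have key := sum_reindex_of_ne_zero (Finset.Icc (-(N : ℤ) - M) (N + M)) (Finset.Icc (-(M : ℤ)) (N + M))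
    (fun m => (f (((j : ℕ) : ℤ) - m + k) - f (((j : ℕ) : ℤ) - m)) ^ 2)
    (fun s : ℤ => ((j : ℕ) : ℤ) - s)
    (by intro a b h; simp only at h; omega)
    (by
      intro m hm _
      simp only [Finset.mem_Icc] at hm
      exact ⟨((j : ℕ) : ℤ) - m, by simp only [Finset.mem_Icc]; omega, by simp⟩)
    (by
      intro s hs hne
      simp only [sub_sub_cancel] at hne
      simp only [Finset.mem_Icc]
      by_contra hout
      apply hne
      rw [lsWindow_eq_zero hf (s := s + k) (by omega), lsWindow_eq_zero hf (s := s) (by omega)]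
      simp)
  simp only [sub_sub_cancel] at key
  rw [key]
  exact Finset.sum_congr rfl fun m _ => by rw [add_sub_right_comm]

/-- `γ_k ≤ 2 M k²` for `k < M` (`f` is 1-Lipschitz and at most `2M` terms are non-zero).
[cite: LiebSolovej2001, App. Thm. 10.1 proof] -/
private theorem lsGamma_le (N : ℕ) {M k : ℕ} {f : ℤ → ℝ}
    (hf : ∀ s : ℤ, f s = max 0 (min ((s : ℝ) + 1) ((M : ℝ) - s))) (hk : k < M) :
    ∑ s ∈ Finset.Icc (-(N : ℤ) - M) (N + M), (f (s + k) - f s) ^ 2 ≤ 2 * M * (k : ℝ) ^ 2 := by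
  have hsub : Finset.Ico (-(M : ℤ)) M ⊆ Finset.Icc (-(N : ℤ) - M) (N + M) := by
    intro s
    simp only [Finset.mem_Ico, Finset.mem_Icc]
    omega
  rw [← Finset.sum_subset hsub ?_]
  · calc ∑ s ∈ Finset.Ico (-(M : ℤ)) M, (f (s + k) - f s) ^ 2
        ≤ ∑ s ∈ Finset.Ico (-(M : ℤ)) M, (k : ℝ) ^ 2 :=
          Finset.sum_le_sum fun s _ => lsWindow_add_sub_sq_le hf s k
      _ = 2 * M * (k : ℝ) ^ 2 := by
          have hcard : (Finset.Ico (-(M : ℤ)) M).card = 2 * M := by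
            simp only [Int.card_Ico]; omega
          rw [Finset.sum_const, hcard, nsmul_eq_mul]
          push_cast
          ring
  · intro s hs hns
    simp only [Finset.mem_Icc] at hs
    simp only [Finset.mem_Ico, not_and_or, not_le, not_lt] at hns
    rw [lsWindow_eq_zero hf (s := s + k) (by omega), lsWindow_eq_zero hf (s := s) (by omega)]
    simp

/-- `γ_k = 2 F₂` for `M ≤ k < N` (disjoint supports).
[cite: LiebSolovej2001, App. Thm. 10.1 proof] -/
private theorem lsGamma_eq {N M k : ℕ} {f : ℤ → ℝ}
    (hf : ∀ s : ℤ, f s = max 0 (min ((s : ℝ) + 1) ((M : ℝ) - s))) (hMk : M ≤ k) (hkN : k < N) :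
    ∑ s ∈ Finset.Icc (-(N : ℤ) - M) (N + M), (f (s + k) - f s) ^ 2 = 2 * ∑ x ∈ Finset.range M, f x ^ 2 := by
  have hcross : ∀ s : ℤ, f (s + k) * f s = 0 := by
    intro s
    by_cases h : f s = 0
    · rw [h, mul_zero]
    · have := lsWindow_ne_zero hf h
      rw [lsWindow_eq_zero hf (s := s + k) (by omega), zero_mul]
  have hexp : ∀ s : ℤ, (f (s + k) - f s) ^ 2
      = f (s + k) ^ 2 + f s ^ 2 := by
    intro s
    linear_combination (-2 : ℝ) * hcross s
  simp_rw [hexp, Finset.sum_add_distrib]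
  have e1 : ∑ s ∈ Finset.Icc (-(N : ℤ) - M) (N + M), f (s + k) ^ 2 = ∑ x ∈ Finset.range M, f x ^ 2 := by
    have key := sum_reindex_of_ne_zero (Finset.range M) (Finset.Icc (-(N : ℤ) - M) (N + M))
      (fun s => f (s + k) ^ 2) (fun t : ℕ => (t : ℤ) - k)
      (by intro a b h; simp only at h; omega)
      (by
        intro s _ hne
        have h := lsWindow_ne_zero hf ((pow_ne_zero_iff two_ne_zero).mp hne)
        exact ⟨(s + k).toNat, by simp only [Finset.mem_range]; omega, by omega⟩)
      (by
        intro t ht _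
        simp only [Finset.mem_range] at ht
        simp only [Finset.mem_Icc]
        omega)
    simp only [sub_add_cancel] at key
    rw [← key]
  have e2 : ∑ s ∈ Finset.Icc (-(N : ℤ) - M) (N + M), f s ^ 2 = ∑ x ∈ Finset.range M, f x ^ 2 := by
    have key := sum_reindex_of_ne_zero (Finset.range M) (Finset.Icc (-(N : ℤ) - M) (N + M))
      (fun s => f s ^ 2) (fun t : ℕ => (t : ℤ))
      (by intro a b h; simp only at h; omega)
      (by
        intro s _ hne
        have h := lsWindow_ne_zero hf ((pow_ne_zero_iff two_ne_zero).mp hne)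
        exact ⟨s.toNat, by simp only [Finset.mem_range]; omega, by omega⟩)
      (by
        intro t ht _
        simp only [Finset.mem_range] at ht
        simp only [Finset.mem_Icc]
        omega)
    rw [← key]
  rw [e1, e2]
  ring

/-- `(φ, 𝒜φ) = ∑_{i,j} conj(φ_i) 𝒜_{ij} φ_j`. [folklore] -/
private theorem quadForm_eq_sum {N : ℕ} (A : Matrix (Fin N) (Fin N) ℂ) (φ : Fin N → ℂ) :
    quadForm A φ = ∑ i : Fin N, ∑ j : Fin N, star (φ i) * A i j * φ j := by
  simp only [quadForm, dotProduct, Matrix.mulVec, Pi.star_apply, Finset.mul_sum, mul_assoc]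

/-- Collecting `∑_{i,j} c_{|i-j|} conj(ψ_i) 𝒜_{ij} ψ_j = ∑_k c_k d_k`.
[cite: LiebSolovej2001, App. Thm. 10.1 proof] -/
private theorem sum_dist_eq_sum_bandPart {N : ℕ} (A : Matrix (Fin N) (Fin N) ℂ) (ψ : Fin N → ℂ)
    (c : ℕ → ℝ) :
    ∑ i : Fin N, ∑ j : Fin N, (c ((i : ℕ).dist j) : ℂ) * (star (ψ i) * A i j * ψ j)
      = ∑ k ∈ Finset.range N, (c k : ℂ) * quadForm (bandPart A k) ψ := by
  have hmem : ∀ i j : Fin N, (i : ℕ).dist j ∈ Finset.range N := by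
    intro i j
    rw [Finset.mem_range]
    have := i.isLt
    have := j.isLt
    rcases le_total (i : ℕ) j with h | h
    · rw [Nat.dist_eq_sub_of_le h]; omega
    · rw [Nat.dist_eq_sub_of_le_right h]; omega
  have hR : ∀ k : ℕ, (c k : ℂ) * quadForm (bandPart A k) ψ = ∑ i : Fin N, ∑ j : Fin N,
      (if (i : ℕ).dist j = k then (c k : ℂ) * (star (ψ i) * A i j * ψ j) else 0) := by
    intro k
    rw [quadForm_eq_sum, Finset.mul_sum]
    refine Finset.sum_congr rfl fun i _ => ?_
    rw [Finset.mul_sum]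
    refine Finset.sum_congr rfl fun j _ => ?_
    rw [bandPart_apply]
    split_ifs <;> simp
  symm
  calc ∑ k ∈ Finset.range N, (c k : ℂ) * quadForm (bandPart A k) ψ
      = ∑ k ∈ Finset.range N, ∑ i : Fin N, ∑ j : Fin N,
          (if (i : ℕ).dist j = k then (c k : ℂ) * (star (ψ i) * A i j * ψ j) else 0) :=
        Finset.sum_congr rfl fun k _ => hR k
    _ = ∑ i : Fin N, ∑ j : Fin N, ∑ k ∈ Finset.range N,
          (if (i : ℕ).dist j = k then (c k : ℂ) * (star (ψ i) * A i j * ψ j) else 0) :=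
        sum_sum_sum_comm _ _
    _ = ∑ i : Fin N, ∑ j : Fin N, (c ((i : ℕ).dist j) : ℂ) * (star (ψ i) * A i j * ψ j) := by
        refine Finset.sum_congr rfl fun i _ => Finset.sum_congr rfl fun j _ => ?_
        rw [Finset.sum_ite_eq, if_pos (hmem i j)]

/-- `(φ^{(m)}, 𝒜 φ^{(m)})` expanded, for the translate `v = φ^{(m)}`, `φ^{(m)}_j = f(j-m) ψ_j`.
[cite: LiebSolovej2001, App. Thm. 10.1 proof] -/
private theorem quadForm_shift {N : ℕ} (f : ℤ → ℝ) (A : Matrix (Fin N) (Fin N) ℂ)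
    (ψ v : Fin N → ℂ) (m : ℤ) (hv : ∀ j : Fin N, v j = ((f (((j : ℕ) : ℤ) - m) : ℝ) : ℂ) * ψ j) :
    quadForm A v = ∑ i : Fin N, ∑ j : Fin N,
      ((f (((i : ℕ) : ℤ) - m) * f (((j : ℕ) : ℤ) - m) : ℝ) : ℂ)
        * (star (ψ i) * A i j * ψ j) := by
  rw [quadForm_eq_sum]
  refine Finset.sum_congr rfl fun i _ => Finset.sum_congr rfl fun j _ => ?_
  rw [hv i, hv j]
  simp only [star_mul', RCLike.star_def, Complex.conj_ofReal]
  push_cast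
  ring

/-- `(v, v) = ∑_j |v_j|²`. [folklore] -/
private theorem star_dotProduct_self_eq {N : ℕ} (v : Fin N → ℂ) :
    star v ⬝ᵥ v = ((∑ j : Fin N, Complex.normSq (v j) : ℝ) : ℂ) := by
  simp only [dotProduct, Pi.star_apply, RCLike.star_def, Complex.ofReal_sum,
    Complex.normSq_eq_conj_mul_self]

/-- `∑_j |v_j|² = 0 → v = 0`. [folklore] -/
private theorem eq_zero_of_sum_normSq_eq_zero {N : ℕ} {v : Fin N → ℂ}
    (h : ∑ j : Fin N, Complex.normSq (v j) = 0) : v = 0 := by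
  funext j
  have := (Finset.sum_eq_zero_iff_of_nonneg (fun j _ => Complex.normSq_nonneg (v j))).mp h j
    (Finset.mem_univ j)
  exact Complex.normSq_eq_zero.mp this

/-- `(φ^{(m)}, φ^{(m)})` expanded. [cite: LiebSolovej2001, App. Thm. 10.1 proof] -/
private theorem sum_normSq_shift {N : ℕ} (f : ℤ → ℝ) (ψ v : Fin N → ℂ) (m : ℤ)
    (hv : ∀ j : Fin N, v j = ((f (((j : ℕ) : ℤ) - m) : ℝ) : ℂ) * ψ j) :
    ∑ j : Fin N, Complex.normSq (v j)
      = ∑ j : Fin N, f (((j : ℕ) : ℤ) - m) ^ 2 * Complex.normSq (ψ j) := by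
  refine Finset.sum_congr rfl fun j _ => ?_
  rw [hv j, Complex.normSq_mul, Complex.normSq_ofReal]
  ring

/-- Scaling a vector by a real number scales `(φ, 𝒜 φ)` quadratically. [folklore] -/
private theorem quadForm_real_smul {N : ℕ} (A : Matrix (Fin N) (Fin N) ℂ) (v : Fin N → ℂ) (c : ℝ) :
    quadForm A ((c : ℂ) • v) = ((c ^ 2 : ℝ) : ℂ) * quadForm A v := by
  simp only [quadForm_eq_sum, Pi.smul_apply, smul_eq_mul, star_mul', RCLike.star_def,
    Complex.conj_ofReal, Finset.mul_sum]
  push_cast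
  exact Finset.sum_congr rfl fun i _ => Finset.sum_congr rfl fun j _ => by ring

/-- Scaling a vector by a real number scales `∑_j |v_j|²` quadratically. [folklore] -/
private theorem sum_normSq_real_smul {N : ℕ} (v : Fin N → ℂ) (c : ℝ) :
    ∑ j : Fin N, Complex.normSq (((c : ℂ) • v) j) = c ^ 2 * ∑ j : Fin N, Complex.normSq (v j) := by
  simp only [Pi.smul_apply, smul_eq_mul, Complex.normSq_mul, Complex.normSq_ofReal,
    Finset.mul_sum]
  exact Finset.sum_congr rfl fun j _ => by ring

/-- **Theorem 10.6 holds** (discharge of the named fact `LSSY2005_thm10_6`, with the explicit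
universal constant `C = 36`), by the Lieb–Solovej averaging argument over the translates
`φ^{(m)}_j = f(j-m)ψ_j` of a tent window. [cite: LSSY2005, Thm. 10.6 (10.8)]
(proof: [LiebSolovej2001, Appendix Thm. 10.1]). -/
theorem LSSY2005_thm10_6_holds : LSSY2005_thm10_6 := by
  refine ⟨36, by norm_num, ?_⟩
  intro N M hM hMN A _hA ψ hψ
  have hMpos : (0 : ℝ) < M := by exact_mod_cast hM
  -- the window `f`, its normalisation `F2 = F₂`, the band sums `γ k = γ_k`,
  -- the translates `v m = φ^{(m)}`, `φ^{(m)}_j = f(j-m) ψ_j`, and `d k = d_k`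
  obtain ⟨f, hf⟩ : ∃ f : ℤ → ℝ, ∀ s : ℤ, f s = max 0 (min ((s : ℝ) + 1) ((M : ℝ) - s)) :=
    ⟨_, fun _ => rfl⟩
  obtain ⟨F2, hF2def⟩ : ∃ F2 : ℝ, F2 = ∑ x ∈ Finset.range M, f x ^ 2 := ⟨_, rfl⟩
  obtain ⟨γ, hγ⟩ : ∃ γ : ℕ → ℝ,
      ∀ k : ℕ, γ k = ∑ s ∈ Finset.Icc (-(N : ℤ) - M) (N + M), (f (s + k) - f s) ^ 2 :=
    ⟨_, fun _ => rfl⟩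
  obtain ⟨v, hv⟩ : ∃ v : ℤ → Fin N → ℂ,
      ∀ m j, v m j = ((f (((j : ℕ) : ℤ) - m) : ℝ) : ℂ) * ψ j := ⟨_, fun _ _ => rfl⟩
  obtain ⟨d, hd⟩ : ∃ d : ℕ → ℂ, ∀ k, d k = quadForm (bandPart A k) ψ := ⟨_, fun _ => rfl⟩
  have hF2 : (M : ℝ) ^ 3 / 36 ≤ F2 := hF2def ▸ lsF2_ge hf
  have hF2pos : 0 < F2 := hF2def ▸ lsF2_pos hf hM
  have hγ_nonneg : ∀ k, 0 ≤ γ k := fun k => hγ k ▸ Finset.sum_nonneg fun _ _ => sq_nonneg _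
  have hγ_zero : γ 0 = 0 := by rw [hγ]; simp
  -- pointwise: `2 ∑_m f(i-m) f(j-m) = 2 F₂ - γ_{|i-j|}`
  have hpt : ∀ i j : Fin N,
      2 * ∑ m ∈ Finset.Icc (-(M : ℤ)) (N + M), f (((i : ℕ) : ℤ) - m) * f (((j : ℕ) : ℤ) - m)
        = 2 * F2 - γ ((i : ℕ).dist j) := by
    intro i j
    have e : ∀ m : ℤ, 2 * (f (((i : ℕ) : ℤ) - m) * f (((j : ℕ) : ℤ) - m))
        = f (((i : ℕ) : ℤ) - m) ^ 2 + f (((j : ℕ) : ℤ) - m) ^ 2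
          - (f (((i : ℕ) : ℤ) - m) - f (((j : ℕ) : ℤ) - m)) ^ 2 := by
      intro m; ring
    rw [Finset.mul_sum, Finset.sum_congr rfl fun m _ => e m, Finset.sum_sub_distrib,
      Finset.sum_add_distrib, sum_lsT_window_sq hf, sum_lsT_window_sq hf, sum_lsT_window_sub_sq hf,
      hF2def, hγ]
    ring
  have hptC : ∀ i j : Fin N,
      ((2 : ℝ) : ℂ) * ((∑ m ∈ Finset.Icc (-(M : ℤ)) (N + M),
          f (((i : ℕ) : ℤ) - m) * f (((j : ℕ) : ℤ) - m) : ℝ) : ℂ)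
        = ((2 : ℝ) : ℂ) * ((F2 : ℝ) : ℂ) - ((γ ((i : ℕ).dist j) : ℝ) : ℂ) := by
    intro i j
    have h := congrArg (fun r : ℝ => (r : ℂ)) (hpt i j)
    simp only [Complex.ofReal_mul, Complex.ofReal_sub] at h
    exact h
  -- first bookkeeping identity: `2 ∑_m (φ^{(m)}, 𝒜 φ^{(m)}) = 2 F₂ λ - ∑_k γ_k d_k`
  have hsumq : ((2 : ℝ) : ℂ) * ∑ m ∈ Finset.Icc (-(M : ℤ)) (N + M), quadForm A (v m)
      = ((2 : ℝ) : ℂ) * ((F2 : ℝ) : ℂ) * quadForm A ψ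
        - ∑ k ∈ Finset.range N, ((γ k : ℝ) : ℂ) * d k := by
    calc ((2 : ℝ) : ℂ) * ∑ m ∈ Finset.Icc (-(M : ℤ)) (N + M), quadForm A (v m)
        = ((2 : ℝ) : ℂ) * ∑ i : Fin N, ∑ j : Fin N, (∑ m ∈ Finset.Icc (-(M : ℤ)) (N + M),
            ((f (((i : ℕ) : ℤ) - m) * f (((j : ℕ) : ℤ) - m) : ℝ) : ℂ))
              * (star (ψ i) * A i j * ψ j) := by
          rw [Finset.sum_congr rfl fun m _ => quadForm_shift f A ψ (v m) m (hv m),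
            sum_sum_sum_comm]
          simp_rw [Finset.sum_mul]
      _ = ∑ i : Fin N, ∑ j : Fin N,
            (((2 : ℝ) : ℂ) * ((F2 : ℝ) : ℂ) - ((γ ((i : ℕ).dist j) : ℝ) : ℂ))
              * (star (ψ i) * A i j * ψ j) := by
          simp_rw [Finset.mul_sum]
          refine Finset.sum_congr rfl fun i _ => Finset.sum_congr rfl fun j _ => ?_
          rw [← mul_assoc, ← Complex.ofReal_sum, hptC i j]
      _ = ((2 : ℝ) : ℂ) * ((F2 : ℝ) : ℂ) * quadForm A ψ
            - ∑ k ∈ Finset.range N, ((γ k : ℝ) : ℂ) * d k := by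
          simp_rw [hd]
          rw [quadForm_eq_sum A ψ, ← sum_dist_eq_sum_bandPart A ψ γ]
          simp_rw [sub_mul, Finset.sum_sub_distrib, Finset.mul_sum]
  -- second bookkeeping identity: `∑_m ‖φ^{(m)}‖² = F₂`
  have hsumn : ∑ m ∈ Finset.Icc (-(M : ℤ)) (N + M), ∑ j : Fin N, Complex.normSq (v m j) = F2 := by
    have hψ' : ∑ j, Complex.normSq (ψ j) = 1 := by
      have h := congrArg Complex.re hψ
      rw [star_dotProduct_self_eq, Complex.ofReal_re] at h
      exact_mod_cast h
    rw [Finset.sum_congr rfl fun m _ => sum_normSq_shift f ψ (v m) m (hv m), Finset.sum_comm]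
    calc ∑ j : Fin N, ∑ m ∈ Finset.Icc (-(M : ℤ)) (N + M), f (((j : ℕ) : ℤ) - m) ^ 2 * Complex.normSq (ψ j)
        = ∑ j : Fin N, F2 * Complex.normSq (ψ j) :=
          Finset.sum_congr rfl fun j _ => by rw [← Finset.sum_mul, sum_lsT_window_sq hf, hF2def]
      _ = F2 := by rw [← Finset.mul_sum, hψ', mul_one]
  -- real parts
  have hre : 2 * ∑ m ∈ Finset.Icc (-(M : ℤ)) (N + M), (quadForm A (v m)).re
      = 2 * F2 * (quadForm A ψ).re - ∑ k ∈ Finset.range N, γ k * (d k).re := by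
    have h := congrArg Complex.re hsumq
    rw [← Complex.ofReal_mul] at h
    simp only [Complex.re_ofReal_mul, Complex.sub_re, Complex.re_sum] at h
    exact h
  -- the shift `σ` (called `R` here) and its bound
  obtain ⟨R, hR⟩ : ∃ R : ℝ,
      R = (∑ k ∈ Finset.range N, γ k * ‖d k‖) / (2 * F2) := ⟨_, rfl⟩
  have hRF : 2 * R * F2 = ∑ k ∈ Finset.range N, γ k * ‖d k‖ := by
    rw [hR]; field_simp
  have hRle : R ≤ 36 / (M : ℝ) ^ 2 * ∑ k ∈ Finset.Ico 1 M, (k : ℝ) ^ 2 * ‖d k‖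
      + 36 * ∑ k ∈ Finset.Ico M N, ‖d k‖ := by
    have hsplit : ∑ k ∈ Finset.range N, γ k * ‖d k‖
        = ∑ k ∈ Finset.Ico 1 M, γ k * ‖d k‖
          + ∑ k ∈ Finset.Ico M N, γ k * ‖d k‖ := by
      rw [Finset.range_eq_Ico, ← Finset.sum_Ico_consecutive _ (Nat.zero_le M) hMN,
        Finset.sum_eq_sum_Ico_succ_bot hM, hγ_zero]
      simp
    rw [hR, hsplit, div_le_iff₀ (by positivity)]
    calc ∑ k ∈ Finset.Ico 1 M, γ k * ‖d k‖
          + ∑ k ∈ Finset.Ico M N, γ k * ‖d k‖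
        ≤ ∑ k ∈ Finset.Ico 1 M, 36 / (M : ℝ) ^ 2 * ((k : ℝ) ^ 2 * ‖d k‖) * (2 * F2)
          + ∑ k ∈ Finset.Ico M N, 36 * ‖d k‖ * (2 * F2) := by
          refine add_le_add (Finset.sum_le_sum fun k hk => ?_) (Finset.sum_le_sum fun k hk => ?_)
          · simp only [Finset.mem_Ico] at hk
            have h1 : γ k ≤ 2 * M * (k : ℝ) ^ 2 := hγ k ▸ lsGamma_le N hf hk.2
            calc γ k * ‖d k‖ ≤ 2 * M * (k : ℝ) ^ 2 * ‖d k‖ := by gcongr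
              _ = 36 / (M : ℝ) ^ 2 * ((k : ℝ) ^ 2 * ‖d k‖) * (2 * ((M : ℝ) ^ 3 / 36)) := by
                field_simp
              _ ≤ 36 / (M : ℝ) ^ 2 * ((k : ℝ) ^ 2 * ‖d k‖) * (2 * F2) := by gcongr
          · simp only [Finset.mem_Ico] at hk
            rw [show γ k = 2 * F2 from hγ k ▸ hF2def ▸ lsGamma_eq hf hk.1 hk.2]
            nlinarith [norm_nonneg (d k), hF2pos]
      _ = (36 / (M : ℝ) ^ 2 * ∑ k ∈ Finset.Ico 1 M, (k : ℝ) ^ 2 * ‖d k‖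
            + 36 * ∑ k ∈ Finset.Ico M N, ‖d k‖) * (2 * F2) := by
          rw [← Finset.sum_mul, ← Finset.sum_mul, ← Finset.mul_sum, ← Finset.mul_sum, ← add_mul]
  -- `∑_m K^{(m)} ≤ 0` with `Λ = Re λ + R`
  have hkey : ∑ m ∈ Finset.Icc (-(M : ℤ)) (N + M), ((quadForm A (v m)).re
      - ((quadForm A ψ).re + R) * ∑ j : Fin N, Complex.normSq (v m j)) ≤ 0 := by
    have hnn : 0 ≤ ∑ k ∈ Finset.range N, γ k * ((d k).re + ‖d k‖) :=
      Finset.sum_nonneg fun k _ => mul_nonneg (hγ_nonneg k)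
        (by linarith [(abs_le.mp (Complex.abs_re_le_norm (d k))).1])
    have hsplit : ∑ k ∈ Finset.range N, γ k * ((d k).re + ‖d k‖)
        = ∑ k ∈ Finset.range N, γ k * (d k).re
          + ∑ k ∈ Finset.range N, γ k * ‖d k‖ := by
      rw [← Finset.sum_add_distrib]
      exact Finset.sum_congr rfl fun k _ => by ring
    have h2 : 2 * ∑ m ∈ Finset.Icc (-(M : ℤ)) (N + M), ((quadForm A (v m)).re
          - ((quadForm A ψ).re + R) * ∑ j : Fin N, Complex.normSq (v m j))
        = -∑ k ∈ Finset.range N, γ k * ((d k).re + ‖d k‖) := by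
      rw [Finset.sum_sub_distrib, ← Finset.mul_sum, hsumn, mul_sub, hre, hsplit, ← hRF]
      ring
    linarith
  -- pigeonhole: some translate is non-zero with Rayleigh quotient `≤ Λ`
  obtain ⟨m, -, hb, hle⟩ : ∃ m ∈ Finset.Icc (-(M : ℤ)) (N + M), ∑ j : Fin N, Complex.normSq (v m j) ≠ 0 ∧
      (quadForm A (v m)).re ≤ ((quadForm A ψ).re + R) * ∑ j : Fin N, Complex.normSq (v m j) := by
    by_contra hcon
    push Not at hcon
    have hterm : ∀ m ∈ Finset.Icc (-(M : ℤ)) (N + M),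
        0 ≤ (quadForm A (v m)).re
          - ((quadForm A ψ).re + R) * ∑ j : Fin N, Complex.normSq (v m j) := by
      intro m hm
      by_cases hb : ∑ j : Fin N, Complex.normSq (v m j) = 0
      · have h0 : v m = 0 := eq_zero_of_sum_normSq_eq_zero hb
        rw [hb, mul_zero, sub_zero, h0]
        simp [quadForm]
      · linarith [hcon m hm hb]
    have hpos : ∃ m ∈ Finset.Icc (-(M : ℤ)) (N + M),
        0 < (quadForm A (v m)).re
          - ((quadForm A ψ).re + R) * ∑ j : Fin N, Complex.normSq (v m j) := by
      by_contra hall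
      push Not at hall
      have hz : ∀ m ∈ Finset.Icc (-(M : ℤ)) (N + M), ∑ j : Fin N, Complex.normSq (v m j) = 0 := by
        intro m hm
        by_contra hb
        linarith [hcon m hm hb, hall m hm]
      rw [Finset.sum_congr rfl hz, Finset.sum_const_zero] at hsumn
      exact hF2pos.ne hsumn
    linarith [Finset.sum_pos' hterm hpos]
  -- normalise the chosen translate
  have hbpos : 0 < ∑ j : Fin N, Complex.normSq (v m j) :=
    lt_of_le_of_ne (Finset.sum_nonneg fun j _ => Complex.normSq_nonneg (v m j)) (Ne.symm hb)
  set c : ℝ := (Real.sqrt (∑ j : Fin N, Complex.normSq (v m j)))⁻¹ with hc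
  have hcb : c ^ 2 * ∑ j : Fin N, Complex.normSq (v m j) = 1 := by
    rw [hc, inv_pow, Real.sq_sqrt hbpos.le, inv_mul_cancel₀ hbpos.ne']
  -- place the window inside `[0, N)`
  obtain ⟨n, hnM, hn⟩ : ∃ n : ℕ, n + M ≤ N ∧ ∀ j : Fin N, ((j : ℕ) < n ∨ n + M ≤ (j : ℕ)) →
      ((((j : ℕ) : ℤ) - m < 0) ∨ (M : ℤ) ≤ ((j : ℕ) : ℤ) - m) := by
    refine ⟨(min (max m 0) ((N : ℤ) - M)).toNat, by omega, ?_⟩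
    intro j hj
    have := j.isLt
    omega
  refine ⟨n, hnM, (c : ℂ) • v m, ?_, ?_, ?_⟩
  · -- normalisation
    rw [star_dotProduct_self_eq, sum_normSq_real_smul, hcb]
    simp
  · -- support
    intro j hj
    have h0 : f (((j : ℕ) : ℤ) - m) = 0 := lsWindow_eq_zero hf (hn j hj)
    rw [Pi.smul_apply, hv m j, h0]
    simp
  · -- the inequality (10.8) with `C = 36`
    have hq' : (quadForm A ((c : ℂ) • v m)).re = c ^ 2 * (quadForm A (v m)).re := by
      rw [quadForm_real_smul, Complex.re_ofReal_mul]
    rw [hq']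
    calc c ^ 2 * (quadForm A (v m)).re
        ≤ c ^ 2 * (((quadForm A ψ).re + R) * ∑ j : Fin N, Complex.normSq (v m j)) :=
          mul_le_mul_of_nonneg_left hle (sq_nonneg c)
      _ = (quadForm A ψ).re + R := by
          rw [show c ^ 2 * (((quadForm A ψ).re + R) * ∑ j : Fin N, Complex.normSq (v m j))
            = ((quadForm A ψ).re + R) * (c ^ 2 * ∑ j : Fin N, Complex.normSq (v m j)) by ring,
            hcb, mul_one]
      _ ≤ _ := by simp only [hd] at hRle; linarith [hRle]

end LiebSolovejProof

end Literature.LinearAlgebra.BandMatrix
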